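import Mathlib
import HarnessLib
import Summits.HubbardSuperconductivity.HubbardSuperconductivity.Theorems.KLProgrammeKLRegimeSplitPredicates
import Summits.HubbardSuperconductivity.HubbardSuperconductivity.Theorems.KLProgrammeDispersionFlowWindow

/-!
# Route `KLProgramme` — first lemmas for child 2 (`Child.Counterterm`, DECOMP C4a in the counterterm scheme): frame algebra
# and the frame geometry on the ANALYSIS window (crux K3 `KLRegimeTwoPointLimit`, stmt-HubbardSuperconductivity-19937; seat p2)

Two groups of facts the inversion (successive approximation of the counterterm `K ↦ -Σ_n ℓ_n(K)`) uses at every step, proved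
here once (no definitions, no facts about the model):

* FRAME ALGEBRA: `sum_coeffExt_mul_eq_eval` (a frame's value as a sum over any larger coefficient square), `eval_fsub`
  (`(A ⊖ B)(p) = A(p) - B(p)`), `evalM_fsub`, and the TELESCOPING of the two-leg pieces
  `sum_eval_klTwoLegPiece : Σ_{n ≤ N} ℓ_n(K)(p) = D_N(K)(p) - K(p)` — so the renormalisation condition «`D_N(K) ≈ 0`» is the
  fixed-point equation `K ≈ -Σ_n ℓ_n(K)`.
* (§3, appended) the SAME on the COVARIANCE window `[-1.05, -0.15]` = `klWindowC` of the FILED children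
  (`KLProgrammeKLRegimeSplitOnWindow.lean`, Hartree shift): `covWindow_geomConstants` (21/4, 3/40, 53/100, 3/80),
  `geomConstants_frameLevel_covWindow` (`A ≤ 7/4`).
* FRAME GEOMETRY ON THE ANALYSIS WINDOW `μ ∈ [-1, -0.15]` (the window of K3's children; p2 g2's
  `geomConstants_frameLevel_window` did the certified window `[-0.4267, -0.1798]`): the free band has the numeric FST II
  constants `(5, 3/40, 53/100, 3/80)` there (`analysisWindow_geomConstants`, from fs-1's closed form), and a frame with
  `FrameGeometry a₀ a₁ A b ē μ K`, `ē ≥ 3/40`, `a₀ ≤ 3/80`, `0 ≤ a₁ ≤ 1/2000`, `A ≤ 2`, `b ≤ 1/100` gives the renormalised band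
  `e_K` EXACTLY the geometric half `GeomConstants (frameLevel μ K) 7 (3/80) (1/2) (3/200)` of `FrameOK`
  (`geomConstants_frameLevel_analysisWindow`): the self-map half of child 2 reduces to the sizes + tangential floor of (E3)
  summed over the scales (`a₀ = O(|U|)`, `a₁ = O(U²)`, `A = O(U² + c)`, `b = O(U² + |U|c)` — small for `U ≤ U₀(c)`, `c ≤ c₁`).

References: BGM 2006 [arXiv:cond-mat/0507686] Lemma 2.1; FST II, CPAM 51 (1998) 1133, Lemma 2.1; HOME/DECOMP.md v8 §2 C4a, §8 (j).
-/

noncomputable section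

namespace Summit.HubbardSuperconductivity.HubbardSuperconductivity.Theorems.KLRegimeSplit

set_option linter.dupNamespace false -- summit = problem name (single-conjunct summit), D-0017

open Real Finset Set Literature.MathematicalPhysics.QuantumLattice Literature.Probability.LatticeModels
open Literature.MathematicalPhysics.QuantumLattice.FermiRG
open Summit.HubbardSuperconductivity.HubbardSuperconductivity.Theorems.KLProgrammeLegKernels
open Summit.HubbardSuperconductivity.HubbardSuperconductivity.Theorems.DispersionFlow

/-! ## §1 Frame algebra -/

/-- Zero-extended coefficients agree with the coefficients inside the degree square. -/
theorem coeffExt_of_le (A : TrigPolyC4v) {m n : ℕ} (hm : m ≤ A.degree) (hn : n ≤ A.degree) :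
    coeffExt A m n = A.coeff m n := by
  simp [coeffExt, hm, hn]

/-- Zero-extended coefficients vanish outside the degree square (first index). -/
theorem coeffExt_of_lt_left (A : TrigPolyC4v) {m n : ℕ} (hm : A.degree < m) : coeffExt A m n = 0 := by
  simp [coeffExt, not_le.mpr hm]

/-- Zero-extended coefficients vanish outside the degree square (second index). -/
theorem coeffExt_of_lt_right (A : TrigPolyC4v) {m n : ℕ} (hn : A.degree < n) : coeffExt A m n = 0 := by
  simp [coeffExt, not_le.mpr hn]

/-- **A frame's value as a sum over any coefficient square containing its degree square** (zero-extended coefficients). -/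
theorem sum_coeffExt_mul_eq_eval (A : TrigPolyC4v) {D : ℕ} (hD : A.degree ≤ D) (p : Fin 2 → ℝ) :
    ∑ m ∈ range (D + 1), ∑ n ∈ range (D + 1), coeffExt A m n * TrigPolyC4v.harmonic m n p = A.eval p := by
  rw [TrigPolyC4v.eval_def]
  have hsub : range (A.degree + 1) ⊆ range (D + 1) := range_mono (by omega)
  symm
  calc ∑ m ∈ range (A.degree + 1), ∑ n ∈ range (A.degree + 1), A.coeff m n * TrigPolyC4v.harmonic m n p
      = ∑ m ∈ range (A.degree + 1), ∑ n ∈ range (A.degree + 1), coeffExt A m n * TrigPolyC4v.harmonic m n p := by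
        refine sum_congr rfl fun m hm => sum_congr rfl fun n hn => ?_
        rw [coeffExt_of_le A (Nat.lt_succ_iff.mp (Finset.mem_range.mp hm))
          (Nat.lt_succ_iff.mp (Finset.mem_range.mp hn))]
    _ = ∑ m ∈ range (A.degree + 1), ∑ n ∈ range (D + 1), coeffExt A m n * TrigPolyC4v.harmonic m n p := by
        refine sum_congr rfl fun m _ => sum_subset hsub fun n hn hn' => ?_
        have : A.degree < n := by
          simp only [Finset.mem_range, not_lt] at hn hn'
          omega
        rw [coeffExt_of_lt_right A this, zero_mul]
    _ = ∑ m ∈ range (D + 1), ∑ n ∈ range (D + 1), coeffExt A m n * TrigPolyC4v.harmonic m n p := by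
        refine sum_subset hsub fun m hm hm' => sum_eq_zero fun n _ => ?_
        have : A.degree < m := by
          simp only [Finset.mem_range, not_lt] at hm hm'
          omega
        rw [coeffExt_of_lt_left A this, zero_mul]

/-- **`(A ⊖ B)(p) = A(p) - B(p)`**: the frame difference evaluates to the difference. -/
theorem eval_fsub (A B : TrigPolyC4v) (p : Fin 2 → ℝ) : (fsub A B).eval p = A.eval p - B.eval p := by
  rw [TrigPolyC4v.eval_def]
  show ∑ m ∈ range (max A.degree B.degree + 1), ∑ n ∈ range (max A.degree B.degree + 1),
      (coeffExt A m n - coeffExt B m n) * TrigPolyC4v.harmonic m n p = A.eval p - B.eval p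
  simp only [sub_mul, sum_sub_distrib]
  rw [sum_coeffExt_mul_eq_eval A (le_max_left _ _), sum_coeffExt_mul_eq_eval B (le_max_right _ _)]

/-- The frame difference on `Momentum`. -/
theorem evalM_fsub (A B : TrigPolyC4v) (q : Momentum) : evalM (fsub A B) q = evalM A q - evalM B q :=
  eval_fsub A B _

/-- The frame difference as a function on `Momentum`. -/
theorem evalM_fsub_eq (A B : TrigPolyC4v) : evalM (fsub A B) = fun q => evalM A q - evalM B q :=
  funext (evalM_fsub A B)

section TwoLeg

variable (L M : ℕ) [NeZero L] [NeZero M]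

/-- **TELESCOPING of the two-leg pieces**: `Σ_{n ≤ N} ℓ_n(K)(p) = D_N(K)(p) - K(p)` — the renormalisation condition
«`D_N(K) ≈ 0`» is the fixed-point equation `K ≈ -Σ_n ℓ_n(K)` of the counterterm map (child 2). -/
theorem sum_eval_klTwoLegPiece (β U μ : ℝ) (K : TrigPolyC4v) (N : ℕ) (p : Fin 2 → ℝ) :
    ∑ n ∈ range (N + 1), (klTwoLegPiece L M β U μ K n).eval p =
      (klTwoLegPoly L M β U μ K N).eval p - K.eval p := by
  induction N with
  | zero => simp [klTwoLegPiece_zero, eval_fsub]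
  | succ N ih => rw [sum_range_succ, ih, klTwoLegPiece_succ, eval_fsub]; ring

/-- The same on `Momentum`: `Σ_{n ≤ N} ℓ_n(K) = D_N(K) - K` as functions. -/
theorem sum_evalM_klTwoLegPiece (β U μ : ℝ) (K : TrigPolyC4v) (N : ℕ) (q : Momentum) :
    ∑ n ∈ range (N + 1), evalM (klTwoLegPiece L M β U μ K n) q =
      evalM (klTwoLegPoly L M β U μ K N) q - evalM K q :=
  sum_eval_klTwoLegPiece L M β U μ K N _

end TwoLeg

/-! ## §2 Frame geometry on the analysis window `μ ∈ [-1, -0.15]` -/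

/-- **Numeric FST II constants of the free band on the analysis window**: for `μ ∈ [-1, -0.15]`,
`GeomConstants (ε - μ) 5 (3/40) (53/100) (3/80)` — from fs-1's closed form `(4+|μ|, -μ/2, √(-μ/2·(4+3μ/2)), -μ/4)` (the
gradient floor's minimum on the window is `√0.283… = 0.532…` at `μ = -0.15`). [folklore] -/
theorem analysisWindow_geomConstants {μ : ℝ} (hμ : μ ∈ klWindow) :
    GeomConstants (fun q : Momentum => squareDispersion 1 0 q - μ) 5 (3 / 40) (53 / 100) (3 / 80) := by
  obtain ⟨hμ₁, hμ₂⟩ := hμ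
  have h83 : -8 / 3 < μ := by linarith
  have h0 : μ < 0 := by linarith
  have hG := Summit.HubbardSuperconductivity.HubbardSuperconductivity.Theorems.klfs_geomConstants h83 h0
  refine GeomConstants.weaken hG ?_ ?_ ?_ ?_ (by norm_num) (by norm_num) (by norm_num)
  · rw [abs_of_neg h0]; linarith
  · linarith
  · apply Real.le_sqrt_of_sq_le
    nlinarith [mul_nonneg (show (0 : ℝ) ≤ μ + 1 by linarith) (show (0 : ℝ) ≤ -0.15 - μ by linarith)]
  · linarith

/-- The arithmetic of the analysis-window constants: with `ρ = a₁/0.53 ≤ 1/1060` and `b ≤ 1/100`,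
`(3/80)(1-ρ)² - 5ρ(2+3ρ) - b ≥ 3/200`. -/
theorem analysisWindow_wmin_bound {a₁ b : ℝ} (ha₁0 : 0 ≤ a₁) (ha₁ : a₁ ≤ 1 / 2000) (hb : b ≤ 1 / 100) :
    (3 : ℝ) / 200 ≤ 3 / 80 * (1 - a₁ / (53 / 100)) ^ 2 - 5 * (a₁ / (53 / 100)) * (2 + 3 * (a₁ / (53 / 100))) - b := by
  have hρ0 : 0 ≤ a₁ / (53 / 100) := by positivity
  have hρ1 : a₁ / (53 / 100) ≤ 1 / 1000 := by rw [div_le_iff₀ (by norm_num)]; linarith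
  nlinarith [mul_nonneg hρ0 hρ0, mul_le_mul hρ1 hρ1 hρ0 (by norm_num)]

/-- **The geometric half of `FrameOK` from frame smallness on the analysis window**: a frame `K` with
`FrameGeometry a₀ a₁ A b ē μ K` (p2 g2: `|K| ≤ a₀`, `‖∇K‖ ≤ a₁`, `‖DʲK‖ ≤ A` for `j ≤ 2`, tangential floor `-b` on the tube
`{|ε - μ| < ē}`), `ē ≥ 3/40`, `a₀ ≤ 3/80`, `0 ≤ a₁ ≤ 1/2000`, `A ≤ 2`, `b ≤ 1/100`, at `μ ∈ [-1, -0.15]`, has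
`GeomConstants (frameLevel μ K) 7 (3/80) (1/2) (3/200)`.  (In the KL regime `a₀ = O(|U|)`, `a₁ = O(U²)`, `A = O(U² + c)`,
`b = O(U² + |U|c)`: the hypotheses hold for `U ≤ U₀(c)`, `c ≤ c₁`.) -/
theorem geomConstants_frameLevel_analysisWindow {μ a₀ a₁ A b ebar : ℝ} {K : TrigPolyC4v} (hμ : μ ∈ klWindow)
    (hK : FrameGeometry a₀ a₁ A b ebar μ K) (hebar : 3 / 40 ≤ ebar) (ha₀ : a₀ ≤ 3 / 80) (ha₁0 : 0 ≤ a₁)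
    (ha₁ : a₁ ≤ 1 / 2000) (hA : A ≤ 2) (hb : b ≤ 1 / 100) :
    GeomConstants (frameLevel μ K) 7 (3 / 80) (1 / 2) (3 / 200) := by
  obtain ⟨hC, h0, h1, hA', hfloor⟩ := hK
  have hG0 := analysisWindow_geomConstants hμ
  have hwb := analysisWindow_wmin_bound ha₁0 ha₁ hb
  have hw' : 0 < 3 / 80 * (1 - a₁ / (53 / 100)) ^ 2 - 5 * (a₁ / (53 / 100)) * (2 + 3 * (a₁ / (53 / 100))) - b := by
    linarith
  have hfl : ∀ p : Momentum, |squareDispersion 1 0 p - μ| < 3 / 40 → ∀ t : Momentum,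
      inner ℝ (gradient ((fun q : Momentum => squareDispersion 1 0 q - μ) + frameShift K) p) t = 0 →
        -b * ‖t‖ ^ 2 ≤ hessQuad (frameShift K) p t := by
    intro p hp t ht
    rw [← frameLevel_eq_add] at ht
    exact hfloor p (hp.trans_le hebar) t ht
  have main := GeomConstants.of_perturbation hG0 (klfs_contDiff_e μ) hC h0 h1 hA' hfl (by linarith) ha₁0
    (by linarith) hw'
  rw [frameLevel_eq_add]
  exact GeomConstants.weaken main (by linarith) (by linarith) (by linarith) hwb (by norm_num) (by norm_num) (by norm_num)

/-! ## §3 Frame geometry on the COVARIANCE window `μ ∈ [-1.05, -0.15]` (the window `klWindowC` of the filed children,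
`KLProgrammeKLRegimeSplitOnWindow.lean`: Hartree shift `μ ↦ μ + U/2`) -/

/-- **Numeric FST II constants of the free band on the covariance window**: for `μ ∈ [-1.05, -0.15]`,
`GeomConstants (ε - μ) (21/4) (3/40) (53/100) (3/80)`. [folklore] -/
theorem covWindow_geomConstants {μ : ℝ} (hμ : μ ∈ Set.Icc (-1.05 : ℝ) (-0.15)) :
    GeomConstants (fun q : Momentum => squareDispersion 1 0 q - μ) (21 / 4) (3 / 40) (53 / 100) (3 / 80) := by
  obtain ⟨hμ₁, hμ₂⟩ := hμ
  have h83 : -8 / 3 < μ := by linarith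
  have h0 : μ < 0 := by linarith
  have hG := Summit.HubbardSuperconductivity.HubbardSuperconductivity.Theorems.klfs_geomConstants h83 h0
  refine GeomConstants.weaken hG ?_ ?_ ?_ ?_ (by norm_num) (by norm_num) (by norm_num)
  · rw [abs_of_neg h0]; linarith
  · linarith
  · apply Real.le_sqrt_of_sq_le
    nlinarith [mul_nonneg (show (0 : ℝ) ≤ μ + 1.05 by linarith) (show (0 : ℝ) ≤ -0.15 - μ by linarith)]
  · linarith

/-- The arithmetic of the covariance-window constants: with `ρ = a₁/0.53 ≤ 1/1060` and `b ≤ 1/100`,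
`(3/80)(1-ρ)² - (21/4)ρ(2+3ρ) - b ≥ 3/200`. -/
theorem covWindow_wmin_bound {a₁ b : ℝ} (ha₁0 : 0 ≤ a₁) (ha₁ : a₁ ≤ 1 / 2000) (hb : b ≤ 1 / 100) :
    (3 : ℝ) / 200 ≤ 3 / 80 * (1 - a₁ / (53 / 100)) ^ 2 - 21 / 4 * (a₁ / (53 / 100)) * (2 + 3 * (a₁ / (53 / 100))) - b := by
  have hρ0 : 0 ≤ a₁ / (53 / 100) := by positivity
  have hρ1 : a₁ / (53 / 100) ≤ 1 / 1000 := by rw [div_le_iff₀ (by norm_num)]; linarith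
  nlinarith [mul_nonneg hρ0 hρ0, mul_le_mul hρ1 hρ1 hρ0 (by norm_num)]

/-- **The geometric half of `FrameOK` from frame smallness on the covariance window** (child 2's self-map step, at the window of
the FILED children): `FrameGeometry a₀ a₁ A b ē μ K` with `ē ≥ 3/40`, `a₀ ≤ 3/80`, `0 ≤ a₁ ≤ 1/2000`, `A ≤ 7/4`, `b ≤ 1/100` at
`μ ∈ [-1.05, -0.15]` gives `GeomConstants (frameLevel μ K) 7 (3/80) (1/2) (3/200)`. -/
theorem geomConstants_frameLevel_covWindow {μ a₀ a₁ A b ebar : ℝ} {K : TrigPolyC4v}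
    (hμ : μ ∈ Set.Icc (-1.05 : ℝ) (-0.15)) (hK : FrameGeometry a₀ a₁ A b ebar μ K) (hebar : 3 / 40 ≤ ebar)
    (ha₀ : a₀ ≤ 3 / 80) (ha₁0 : 0 ≤ a₁) (ha₁ : a₁ ≤ 1 / 2000) (hA : A ≤ 7 / 4) (hb : b ≤ 1 / 100) :
    GeomConstants (frameLevel μ K) 7 (3 / 80) (1 / 2) (3 / 200) := by
  obtain ⟨hC, h0, h1, hA', hfloor⟩ := hK
  have hG0 := covWindow_geomConstants hμ
  have hwb := covWindow_wmin_bound ha₁0 ha₁ hb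
  have hw' : 0 < 3 / 80 * (1 - a₁ / (53 / 100)) ^ 2 - 21 / 4 * (a₁ / (53 / 100)) * (2 + 3 * (a₁ / (53 / 100))) - b := by
    linarith
  have hfl : ∀ p : Momentum, |squareDispersion 1 0 p - μ| < 3 / 40 → ∀ t : Momentum,
      inner ℝ (gradient ((fun q : Momentum => squareDispersion 1 0 q - μ) + frameShift K) p) t = 0 →
        -b * ‖t‖ ^ 2 ≤ hessQuad (frameShift K) p t := by
    intro p hp t ht
    rw [← frameLevel_eq_add] at ht
    exact hfloor p (hp.trans_le hebar) t ht
  have main := GeomConstants.of_perturbation hG0 (klfs_contDiff_e μ) hC h0 h1 hA' hfl (by linarith) ha₁0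
    (by linarith) hw'
  rw [frameLevel_eq_add]
  exact GeomConstants.weaken main (by linarith) (by linarith) (by linarith) hwb (by norm_num) (by norm_num) (by norm_num)

end Summit.HubbardSuperconductivity.HubbardSuperconductivity.Theorems.KLRegimeSplit

end
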